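import Literature.NumberTheory.Transcendental.PkappaTheta
import Literature.NumberTheory.Transcendental.PkappaThetaBlockRelations
import HarnessLib

/-!
# Chart identities among the theta functions of `P_κ`

Topic `Literature/NumberTheory/Transcendental`. A brick for the theta-model instance of the
abstract zero estimate (`ZeroEstModel.lean`, fields `surj` and `locRel`): the polynomial
identities expressing every theta function of `P_κ` through the functions of one chart
`M_c : γ → Fin 3`. With `Θ^P_{(M,none)} = ∏_b P_{M b}(z'_b)` and
`Θ^P_{(M,some e)} = s_e Θ^P_{(M,none)} - ∑_b κ_{eb} Z_{M b}(z'_b) ∏_{b'≠b} P_{M b'}(z'_{b'})`: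

* `thetaPnone_update` — `Θ^P_{(M_c[b↦i],none)} = P_i(z'_b) ∏_{b'≠b} P_{M_c b'}(z'_{b'})`;
* `thetaPnone_mul_prod_eq` (product relation) —
  `Θ^P_{(M,none)} · ∏_b ∏_{b'≠b} P_{M_c b'} = ∏_b Θ^P_{(M_c[b ↦ M b],none)}`;
* `thetaPsome_mul_sub` (fibre relation) —
  `Θ^P_{(M,e)} Θ^P_{(M_c,none)} - Θ^P_{(M_c,e)} Θ^P_{(M,none)}
   = -∑_b κ_{eb} (Z_{Mb} P_{M_c b} - Z_{M_c b} P_{M b})(z'_b) ∏_{b'≠b} P_{M b'} P_{M_c b'}`,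
  where `Z_i P_j - Z_j P_i` is the quadratic `zpVal i j` in `P₀, P₁, P₂`
  (`PkappaThetaBlockRelations.lean`);
* `thetaPnone_cubic` (block cubic in a chart) — the Weierstrass cubic among
  `Θ^P_{(M_c[b↦0],none)}, Θ^P_{(M_c[b↦1],none)}, Θ^P_{(M_c[b↦2],none)}`.

All identities hold at every point of `Lie M_κ` (no divisor condition). Everything is PROVED.

## References

* Yu. V. Nesterenko, P. Philippon (eds.), *Introduction to Algebraic Independence Theory*,
  LNM 1752, Springer 2001, Ch. 11 §2.1 (the embedding). [NesterenkoPhilippon2001]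
-/

noncomputable section

open Complex

namespace Literature.NumberTheory.Transcendental

namespace GaGmE

namespace Std

variable {β γ δ : Type} [Fintype β] [Fintype γ] [Fintype δ] [DecidableEq γ]
variable (L : PeriodPair) (κM : δ → γ → Kbar)

/-! ### One block modified -/

omit [Fintype β] [Fintype δ] in
/-- **`Θ^P_{(M[b↦i],none)} = P_i(z'_b) · ∏_{b'≠b} P_{M b'}(z'_{b'})`.** [folklore] -/
theorem thetaPnone_update (M : γ → Fin 3) (b : γ) (i : Fin 3) (w : β ⊕ (γ ⊕ δ) → ℂ) :
    thetaPnone (δ := δ) L (Function.update M b i) w =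
      L.univExtP i (w (iz b)) * ∏ b' ∈ Finset.univ.erase b, L.univExtP (M b') (w (iz b')) := by
  unfold thetaPnone
  rw [← Finset.mul_prod_erase Finset.univ _ (Finset.mem_univ b), Function.update_self]
  congr 1
  exact Finset.prod_congr rfl fun b' hb' => by rw [Function.update_of_ne (Finset.ne_of_mem_erase hb')]

omit [Fintype β] [Fintype δ] in
/-- `Θ^P_{(M,none)} = P_{M b}(z'_b) · ∏_{b'≠b} P_{M b'}`. [folklore] -/
theorem thetaPnone_eq_mul_erase (M : γ → Fin 3) (b : γ) (w : β ⊕ (γ ⊕ δ) → ℂ) :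
    thetaPnone (δ := δ) L M w = L.univExtP (M b) (w (iz b)) * ∏ b' ∈ Finset.univ.erase b, L.univExtP (M b') (w (iz b')) := by
  unfold thetaPnone
  rw [← Finset.mul_prod_erase Finset.univ _ (Finset.mem_univ b)]

/-! ### The product relation -/

omit [Fintype β] [Fintype δ] in
/-- **Product relation**: `Θ^P_{(M,none)} · ∏_b ∏_{b'≠b} P_{M_c b'} = ∏_b Θ^P_{(M_c[b ↦ M b],none)}`.
[folklore] -/
theorem thetaPnone_mul_prod_eq (M Mc : γ → Fin 3) (w : β ⊕ (γ ⊕ δ) → ℂ) :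
    thetaPnone (δ := δ) L M w * ∏ b, ∏ b' ∈ Finset.univ.erase b, L.univExtP (Mc b') (w (iz b')) =
      ∏ b, thetaPnone (δ := δ) L (Function.update Mc b (M b)) w := by
  simp_rw [thetaPnone_update]
  rw [Finset.prod_mul_distrib]
  rfl

omit [Fintype β] [Fintype δ] in
/-- The double product is a power of the chart function: `∏_b ∏_{b'≠b} P_{M_c b'} = (Θ^P_{(M_c,none)})^{|γ|-1}`.
[folklore] -/
theorem prod_prod_erase_eq_pow (Mc : γ → Fin 3) (w : β ⊕ (γ ⊕ δ) → ℂ) :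
    ∏ b, ∏ b' ∈ Finset.univ.erase b, L.univExtP (Mc b') (w (iz b')) =
      thetaPnone (δ := δ) L Mc w ^ (Fintype.card γ - 1) := by
  classical
  unfold thetaPnone
  rw [Finset.prod_comm' (t' := Finset.univ) (s' := fun b' => Finset.univ.erase b')
    (h := fun b b' => by simp [Finset.mem_erase, eq_comm])]
  rw [← Finset.prod_pow]
  refine Finset.prod_congr rfl fun b' _ => ?_
  rw [Finset.prod_const, Finset.card_erase_of_mem (Finset.mem_univ _), Finset.card_univ]

/-! ### The block cubic in a chart -/

omit [Fintype β] [Fintype δ] in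
/-- **The Weierstrass cubic among `Θ^P_{(M_c[b↦i],none)}`, `i = 0, 1, 2`.**
[cite: WhittakerWatson1927, §20.22] -/
theorem thetaPnone_cubic (Mc : γ → Fin 3) (b : γ) (w : β ⊕ (γ ⊕ δ) → ℂ) :
    thetaPnone (δ := δ) L (Function.update Mc b 2) w ^ 2 * thetaPnone (δ := δ) L (Function.update Mc b 0) w =
      4 * thetaPnone (δ := δ) L (Function.update Mc b 1) w ^ 3 -
        L.g₂ * thetaPnone (δ := δ) L (Function.update Mc b 1) w * thetaPnone (δ := δ) L (Function.update Mc b 0) w ^ 2 -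
        L.g₃ * thetaPnone (δ := δ) L (Function.update Mc b 0) w ^ 3 := by
  simp only [thetaPnone_update]
  have h := L.univExtP_cubic (w (iz b))
  set C := ∏ b' ∈ Finset.univ.erase b, L.univExtP (Mc b') (w (iz b'))
  linear_combination C ^ 3 * h

/-! ### The fibre relation -/

/-- `Z_i P_j - Z_j P_i` as a function. [folklore] -/
def _root_.PeriodPair.zpVal (i j : Fin 3) (z : ℂ) : ℂ := L.univExtZ i z * L.univExtP j z - L.univExtZ j z * L.univExtP i z

/-- **`Z_i P_j - Z_j P_i` is a quadratic polynomial in `P₀, P₁, P₂`**: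
`0` on the diagonal, `Z₀P₁ - Z₁P₀ = 0`, `Z₀P₂ - Z₂P₀ = -2P₁²`, `2(Z₁P₂ - Z₂P₁) = -(P₂² + g₂P₀P₁ + g₃P₀²)`.
[cite: WhittakerWatson1927, §20.22] -/
theorem _root_.PeriodPair.zpVal_eq (i j : Fin 3) (z : ℂ) :
    L.zpVal i j z =
      (![![0, 0, -2 * L.univExtP 1 z ^ 2],
         ![0, 0, -(L.univExtP 2 z ^ 2 + L.g₂ * L.univExtP 0 z * L.univExtP 1 z + L.g₃ * L.univExtP 0 z ^ 2) / 2],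
         ![2 * L.univExtP 1 z ^ 2, (L.univExtP 2 z ^ 2 + L.g₂ * L.univExtP 0 z * L.univExtP 1 z + L.g₃ * L.univExtP 0 z ^ 2) / 2, 0]]
        i j : ℂ) := by
  have h01 := L.univExtZ_zero_mul_univExtP_one z
  have h02 := L.univExtZ_zero_mul_univExtP_two_sub z
  have h12 := L.two_mul_univExtZ_one_mul_univExtP_two_sub z
  unfold PeriodPair.zpVal
  fin_cases i <;> fin_cases j <;> simp <;> first
    | linear_combination h01 | linear_combination h02 | linear_combination (1 / 2 : ℂ) * h12
    | linear_combination -h01 | linear_combination -h02 | linear_combination (-(1 / 2) : ℂ) * h12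

omit [Fintype β] [Fintype δ] in
/-- **Fibre relation**:
`Θ^P_{(M,e)} Θ^P_{(M_c,none)} - Θ^P_{(M_c,e)} Θ^P_{(M,none)} = -∑_b κ_{eb} (Z_{Mb}P_{M_c b} - Z_{M_c b}P_{Mb})(z'_b) ∏_{b'≠b} P_{M b'} P_{M_c b'}`
(the `s_e`-terms cancel). [folklore] -/
theorem thetaPsome_mul_sub (M Mc : γ → Fin 3) (e : δ) (w : β ⊕ (γ ⊕ δ) → ℂ) :
    thetaPsome L κM M e w * thetaPnone (δ := δ) L Mc w - thetaPsome L κM Mc e w * thetaPnone (δ := δ) L M w =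
      -∑ b, (κM e b : ℂ) * (L.zpVal (M b) (Mc b) (w (iz b)) *
        ∏ b' ∈ Finset.univ.erase b, (L.univExtP (M b') (w (iz b')) * L.univExtP (Mc b') (w (iz b')))) := by
  unfold thetaPsome
  have hM : ∀ b, thetaPnone (δ := δ) L M w =
      L.univExtP (M b) (w (iz b)) * ∏ b' ∈ Finset.univ.erase b, L.univExtP (M b') (w (iz b')) :=
    fun b => thetaPnone_eq_mul_erase L M b w
  have hMc : ∀ b, thetaPnone (δ := δ) L Mc w =
      L.univExtP (Mc b) (w (iz b)) * ∏ b' ∈ Finset.univ.erase b, L.univExtP (Mc b') (w (iz b')) :=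
    fun b => thetaPnone_eq_mul_erase L Mc b w
  -- expand and match the sums termwise
  have key : ∀ b, (κM e b : ℂ) * (L.univExtZ (M b) (w (iz b)) * ∏ b' ∈ Finset.univ.erase b, L.univExtP (M b') (w (iz b'))) *
        thetaPnone (δ := δ) L Mc w -
      (κM e b : ℂ) * (L.univExtZ (Mc b) (w (iz b)) * ∏ b' ∈ Finset.univ.erase b, L.univExtP (Mc b') (w (iz b'))) *
        thetaPnone (δ := δ) L M w =
      (κM e b : ℂ) * (L.zpVal (M b) (Mc b) (w (iz b)) *
        ∏ b' ∈ Finset.univ.erase b, (L.univExtP (M b') (w (iz b')) * L.univExtP (Mc b') (w (iz b')))) := by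
    intro b
    rw [hMc b, hM b, Finset.prod_mul_distrib, PeriodPair.zpVal]
    ring
  calc _ = -(∑ b, ((κM e b : ℂ) * (L.univExtZ (M b) (w (iz b)) * ∏ b' ∈ Finset.univ.erase b, L.univExtP (M b') (w (iz b'))) *
              thetaPnone (δ := δ) L Mc w -
            (κM e b : ℂ) * (L.univExtZ (Mc b) (w (iz b)) * ∏ b' ∈ Finset.univ.erase b, L.univExtP (Mc b') (w (iz b'))) *
              thetaPnone (δ := δ) L M w)) := by
          rw [Finset.sum_sub_distrib, ← Finset.sum_mul, ← Finset.sum_mul]; ring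
    _ = _ := by rw [Finset.sum_congr rfl fun b _ => key b]

end Std

end GaGmE

end Literature.NumberTheory.Transcendental
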